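import Summits.QuantumFields.YangMills.Theorems.DiagonalMirrorRPRWilsonDiagonalModelDefs
import Summits.QuantumFields.YangMills.Theorems.PencilRigidityDiagonalMirrorRPRStubRpClosureLattice
import Literature.MathematicalPhysics.QuantumFieldTheory.LatticeGaugeProofs

/-!
# Crux `DiagonalMirrorRPR` (stmt-QuantumFields-10604), line `sign-twisted-diagonal-trace`, construction F1_diag
# (director-ym O4 WORD 3 (A)): the Wilson DIAGONAL two-step transfer construction — kernel-level theorems

Helper for the crux `DiagonalMirrorRPR` of `YangMills` (routes `IsotropyFromPowerCounting`, `MirrorModularBoosts`,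
`PencilRigidity`; item stmt-QuantumFields-10604), attached `--supports … --as helper`; it closes nothing by itself.
Vocabulary: `…Theorems.DiagonalMirrorRPRWilsonDiagonalModelDefs` (light-cone chart `diagSite`, layers `layerEquiv`, step
table `stepPlaq`, step action, two-step kernel `stepKernel ρ β`, `diagCyclicTrace`).

PROVED HERE (Mathlib + landed `…StubRpClosureDefs`/`…StubRpClosureLattice`/`LatticeGaugeProofs` only; no sorry):

* §3′ `stepPlaq_layerRead_fst/snd` — the step table of the layers `(Z_v, Z_{v+1})` read off a sheared box configuration
  IS Wilson's plaquette table: planes `(0,1),(0,2),(0,3),(2,3)` based in slab `v`, planes `(1,2),(1,3)` based in slab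
  `v+1`; `taction_true_eq_sum_stepAction` — **`Σ_x Σ_{i<j} Re tr ρ(U_p) = Σ_{v : ℤ_M} stepAction ρ Z_v Z_{v+1}`** (every
  plaquette booked exactly once; re-indexing `v ↦ v+1` of the second group); `tweight_true_eq_prod_stepKernel` —
  `exp(β·action) = ∏_v K(Z_v, Z_{v+1})`; regularity of `K` (`continuous_stepKernel`, `exists_norm_stepKernel_le`,
  `stronglyMeasurable_stepKernel`).
* §4 `measurePreserving_layerEquiv` (edge relabelling + currying preserve product Haar), **`tZ_true_eq_diagCyclicTrace`**
  (the sheared box partition function is the cyclic trace of `K`), `diagCyclicTrace_pos`, `integral_mul_tweight_true_eq`,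
  `texp_true_eq` (`⟨F⟩ = (∫ F(assembled layers) ∏_v K) / ∫ ∏_v K`).
* §5 the standard torus: `wilsonAction_diagConfig` (`S ∘ diagConfig = N_c·#plaquettes − taction ρ true`),
  `measurePreserving_diagConfigEquiv`, **`integral_wilsonMeasure_eq_texp_true`** (`∫ F dμ_{Wilson} = Re ⟨F ∘ diagConfig⟩_{sheared}`),
  **`integral_wilsonMeasure_eq_diagCyclic`** and **`latticeSchwinger_eq_diagCyclic`** — the scheme's lattice `n`-point
  functions at step `k` are normalised cyclic `S_k`-fold integrals of the diagonal two-step kernel with the product of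
  smeared fields inserted: the path-integral side of every `Tr (X A^{S−2d})`-type identity of the interface.

OWED (see the Defs file docstring): the operator/spectral layer (`A = Ê^{1/2} Ô Ê^{1/2}`, Hilbert–Schmidt, eigen-data,
`Σ λ_j^m = diagCyclicTrace`) and the pairing layer (`pairing_eq`, `weight_dom` of `DiagonalSliceModel`); hence NO
`def wilsonDiagonalModel : DiagonalSliceModel r sch` in this generation.  HONEST FRAMING: a construction helper; nothing about
D_old ⟨10604⟩, the RP crux of the FOLD restate, or the summit is proved; the Yang–Mills mass gap is NOT proved here or
anywhere in the tree.

References: K. Osterwalder, E. Seiler, Ann. Phys. 110 (1978) §2–3; E. Seiler, LNP 159 (1982) Ch. 2; M. Lüscher, Comm.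
Math. Phys. 54 (1977) 283.
-/

set_option autoImplicit false

noncomputable section

open MeasureTheory
open Literature.MathematicalPhysics.QuantumLattice Literature.MathematicalPhysics.QuantumFieldTheory
open Summit.QuantumFields.YangMills.Cruxes.DiagonalMirrorRPR.ParityBridgeColdTraces

namespace Summit.QuantumFields.YangMills.Cruxes.DiagonalMirrorRPR.SignTwistedDiagonalTrace.WilsonDiagonal

/-! ## §3′ The step table reads Wilson's plaquettes; the diagonal decomposition of the action -/

section StepTable

variable {n₁ N : ℕ} [NeZero n₁] [NeZero N] {G : Type*} [Group G] {Nc : ℕ} (ρ : G →* Matrix (Fin Nc) (Fin Nc) ℂ)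

omit [NeZero n₁] [NeZero N] in
/-- The four plaquettes `(0,1)`, `(0,2)`, `(0,3)`, `(2,3)` based at `(v, s)` are the corresponding entries of the step
table of the layers `v`, `v+1`. -/
theorem stepPlaq_layerRead_fst {M : ℕ} (U : TConfig M n₁ N G) (t : ZMod M) (s : SlabSite n₁ N) :
    stepPlaq (layerRead U t) (layerRead U (t + 1)) s 0 1 = tplaq true U (t, s) 0 1 ∧
    stepPlaq (layerRead U t) (layerRead U (t + 1)) s 0 2 = tplaq true U (t, s) 0 2 ∧
    stepPlaq (layerRead U t) (layerRead U (t + 1)) s 0 3 = tplaq true U (t, s) 0 3 ∧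
    stepPlaq (layerRead U t) (layerRead U (t + 1)) s 2 3 = tplaq true U (t, s) 2 3 := by
  simp [stepPlaq, tplaq, tstep, slabStep, layerRead_apply, sub_eq_add_neg, Prod.mk_zero_zero]

omit [NeZero n₁] [NeZero N] in
/-- The two plaquettes `(1,2)`, `(1,3)` based at `(v+1, s)` are the corresponding entries of the step table of the
layers `v`, `v+1` (the sheared `e₁`-step goes BACK one slab). -/
theorem stepPlaq_layerRead_snd {M : ℕ} (U : TConfig M n₁ N G) (t : ZMod M) (s : SlabSite n₁ N) :
    stepPlaq (layerRead U t) (layerRead U (t + 1)) s 1 2 = tplaq true U (t + 1, s) 1 2 ∧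
    stepPlaq (layerRead U t) (layerRead U (t + 1)) s 1 3 = tplaq true U (t + 1, s) 1 3 := by
  simp [stepPlaq, tplaq, tstep, slabStep, layerRead_apply, sub_eq_add_neg, Prod.mk_zero_zero]

omit [NeZero n₁] [NeZero N] in
/-- The ordered-pair plane sum over `Fin 4` is the explicit six-term sum. -/
theorem sum_fin4_lt (f : Fin 4 → Fin 4 → ℝ) :
    ∑ i : Fin 4, ∑ j : Fin 4, (if i < j then f i j else 0) = f 0 1 + f 0 2 + f 0 3 + f 1 2 + f 1 3 + f 2 3 := by
  simp +decide [Fin.sum_univ_four]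
  ring

/-- **The diagonal decomposition of Wilson's action**: on the sheared box torus, the plaquette sum is the sum over
the slabs `v` of the step actions of consecutive layers `(Z_v, Z_{v+1})`. -/
theorem taction_true_eq_sum_stepAction {M : ℕ} [NeZero M] (U : TConfig M n₁ N G) :
    taction ρ true U = ∑ t : ZMod M, stepAction ρ (layerRead U t) (layerRead U (t + 1)) := by
  -- the six plaquette terms based at a site
  set p : ZMod M → SlabSite n₁ N → Fin 4 → Fin 4 → ℝ := fun τ s i j => (ρ (tplaq true U (τ, s) i j)).trace.re
    with hp
  have hL : taction ρ true U = ∑ τ : ZMod M, ∑ s : SlabSite n₁ N,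
      ((p τ s 0 1 + p τ s 0 2 + p τ s 0 3 + p τ s 2 3) + (p τ s 1 2 + p τ s 1 3)) := by
    unfold taction
    rw [Fintype.sum_prod_type]
    refine Finset.sum_congr rfl fun τ _ => Finset.sum_congr rfl fun s _ => ?_
    rw [sum_fin4_lt]
    simp only [hp]
    ring
  have hR : ∀ t : ZMod M, stepAction ρ (layerRead U t) (layerRead U (t + 1)) =
      ∑ s : SlabSite n₁ N, ((p t s 0 1 + p t s 0 2 + p t s 0 3 + p t s 2 3) + (p (t + 1) s 1 2 + p (t + 1) s 1 3)) := by
    intro t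
    unfold stepAction
    refine Finset.sum_congr rfl fun s _ => ?_
    obtain ⟨h01, h02, h03, h23⟩ := stepPlaq_layerRead_fst U t s
    obtain ⟨h12, h13⟩ := stepPlaq_layerRead_snd U t s
    rw [sum_fin4_lt, h01, h02, h03, h23, h12, h13]
    simp only [hp]
    ring
  -- regroup: `Σ_τ (A τ + B τ) = Σ_t (A t + B (t+1))`
  set A : ZMod M → ℝ := fun τ => ∑ s : SlabSite n₁ N, (p τ s 0 1 + p τ s 0 2 + p τ s 0 3 + p τ s 2 3) with hA
  set B : ZMod M → ℝ := fun τ => ∑ s : SlabSite n₁ N, (p τ s 1 2 + p τ s 1 3) with hB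
  have hL' : taction ρ true U = ∑ τ : ZMod M, (A τ + B τ) := by
    rw [hL]
    exact Finset.sum_congr rfl fun τ _ => Finset.sum_add_distrib
  have hR' : ∀ t : ZMod M, stepAction ρ (layerRead U t) (layerRead U (t + 1)) = A t + B (t + 1) := by
    intro t
    rw [hR]
    exact Finset.sum_add_distrib
  rw [hL']
  simp only [hR']
  rw [Finset.sum_add_distrib, Finset.sum_add_distrib]
  congr 1
  exact (Fintype.sum_equiv (Equiv.addRight (1 : ZMod M)) (fun t => B (t + 1)) B fun _ => rfl).symm

/-- **The Boltzmann weight factorises along the diagonal**: `exp(β · action) = ∏_v K(Z_v, Z_{v+1})`. -/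
theorem tweight_true_eq_prod_stepKernel {M : ℕ} [NeZero M] (β : ℝ) (U : TConfig M n₁ N G) :
    tweight ρ β true U = ∏ t : ZMod M, stepKernel ρ β (layerRead U t) (layerRead U (t + 1)) := by
  unfold tweight stepKernel
  rw [taction_true_eq_sum_stepAction, Finset.mul_sum, Real.exp_sum]

end StepTable

/-! ## §3″ Regularity of the step kernel (the hypotheses of the tree's kernel-operator files) -/

section Regularity

variable {n₁ N : ℕ} [NeZero n₁] [NeZero N] {G : Type*} [Group G] {Nc : ℕ} (ρ : G →* Matrix (Fin Nc) (Fin Nc) ℂ)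
variable [TopologicalSpace G] [IsTopologicalGroup G] [CompactSpace G] [MeasurableSpace G] [BorelSpace G]

omit [NeZero n₁] [NeZero N] [MeasurableSpace G] [BorelSpace G] [CompactSpace G] in
/-- Every entry of the step table is a continuous function of the pair of layers. -/
theorem continuous_stepPlaq (s : SlabSite n₁ N) (i j : Fin 4) :
    Continuous fun ZZ' : LayerCfg n₁ N G × LayerCfg n₁ N G => stepPlaq ZZ'.1 ZZ'.2 s i j := by
  fin_cases i <;> fin_cases j <;> simp [stepPlaq] <;> fun_prop

omit [MeasurableSpace G] [BorelSpace G] [CompactSpace G] in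
/-- The step action is jointly continuous in the two layers (continuous `ρ`). -/
theorem continuous_stepAction (hρ : Continuous ρ) :
    Continuous fun ZZ' : LayerCfg n₁ N G × LayerCfg n₁ N G => stepAction ρ ZZ'.1 ZZ'.2 := by
  unfold stepAction
  refine continuous_finsetSum _ fun s _ => continuous_finsetSum _ fun i _ =>
    continuous_finsetSum _ fun j _ => ?_
  split_ifs
  · exact Complex.continuous_re.comp (Continuous.matrix_trace (hρ.comp (continuous_stepPlaq s i j)))
  · exact continuous_const

omit [MeasurableSpace G] [BorelSpace G] [CompactSpace G] in
/-- The step kernel is jointly continuous. -/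
theorem continuous_stepKernel (hρ : Continuous ρ) (β : ℝ) :
    Continuous (Function.uncurry (stepKernel (n₁ := n₁) (N := N) ρ β) :
      LayerCfg n₁ N G × LayerCfg n₁ N G → ℝ) :=
  Real.continuous_exp.comp (continuous_const.mul (continuous_stepAction ρ hρ))

omit [MeasurableSpace G] [BorelSpace G] in
/-- The step kernel is bounded (a continuous function on the compact group `G^{LayerIdx} × G^{LayerIdx}`). -/
theorem exists_stepKernel_le (hρ : Continuous ρ) (β : ℝ) :
    ∃ C : ℝ, ∀ Z Z' : LayerCfg n₁ N G, stepKernel ρ β Z Z' ≤ C := by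
  obtain ⟨C, hC⟩ := (isCompact_univ.image (continuous_stepKernel (n₁ := n₁) (N := N) ρ hρ β)).isBounded.bddAbove
  exact ⟨C, fun Z Z' => hC ⟨(Z, Z'), Set.mem_univ _, rfl⟩⟩

omit [MeasurableSpace G] [BorelSpace G] in
/-- The step kernel is bounded in norm: `‖K(Z, Z')‖ ≤ C` (the form the kernel-operator files consume). -/
theorem exists_norm_stepKernel_le (hρ : Continuous ρ) (β : ℝ) :
    ∃ C : ℝ, ∀ Z Z' : LayerCfg n₁ N G, ‖stepKernel ρ β Z Z'‖ ≤ C := by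
  obtain ⟨C, hC⟩ := exists_stepKernel_le (n₁ := n₁) (N := N) ρ hρ β
  exact ⟨C, fun Z Z' => by rw [Real.norm_of_nonneg (stepKernel_pos ρ β Z Z').le]; exact hC Z Z'⟩

omit [CompactSpace G] in
/-- The step kernel is (strongly) measurable as a function of the pair (second countability makes the product Borel). -/
theorem stronglyMeasurable_stepKernel [SecondCountableTopology G] (hρ : Continuous ρ) (β : ℝ) :
    StronglyMeasurable (Function.uncurry (stepKernel (n₁ := n₁) (N := N) ρ β) :
      LayerCfg n₁ N G × LayerCfg n₁ N G → ℝ) :=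
  (continuous_stepKernel ρ hρ β).measurable.stronglyMeasurable

end Regularity

/-! ## §4 The partition function and the expectations as cyclic integrals of the step kernel -/

section Cyclic

variable {M n₁ N : ℕ} [NeZero M] [NeZero n₁] [NeZero N]
variable {G : Type} [Group G] [TopologicalSpace G] [IsTopologicalGroup G] [CompactSpace G] [MeasurableSpace G]
  [BorelSpace G] {Nc : ℕ} (ρ : G →* Matrix (Fin Nc) (Fin Nc) ℂ) (β : ℝ)

/-- Currying is measure preserving for finite products of the Haar probability measure. -/
theorem measurePreserving_curry_haar (ι κ : Type) [Fintype ι] [Fintype κ] :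
    MeasurePreserving (MeasurableEquiv.curry ι κ G) (Measure.pi fun _ : ι × κ => haarProbability G)
      (Measure.pi fun _ : ι => Measure.pi fun _ : κ => haarProbability G) := by
  -- adapted from `measurePreserving_curry` (Literature/…/Balaban1983to89/StrongCouplingOpenWindow)
  refine ⟨(MeasurableEquiv.curry ι κ G).measurable, ?_⟩
  have h := Measure.infinitePi_map_curry (X := G) (fun (_ : ι) (_ : κ) => haarProbability G)
  simpa only [Measure.infinitePi_eq_pi] using h

/-- **The layer equivalence preserves product Haar measure.** -/
theorem measurePreserving_layerEquiv :
    MeasurePreserving (layerEquiv : TConfig M n₁ N G ≃ᵐ (ZMod M → LayerCfg n₁ N G)) (thaar M n₁ N)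
      (Measure.pi fun _ : ZMod M => layerHaar n₁ N G) := by
  unfold layerEquiv thaar layerHaar
  exact (measurePreserving_piCongrLeft (μ := fun _ : ZMod M × LayerIdx n₁ N => haarProbability G)
    (layerEdge (M := M) (n₁ := n₁) (N := N))).trans (measurePreserving_curry_haar (ZMod M) (LayerIdx n₁ N))

/-- **The partition function of the sheared box torus is the cyclic trace of the step kernel**:
`Z(M, n₁, N; sheared) = ∫ ∏_{v : ℤ_M} K(Z_v, Z_{v+1}) dHaar`. -/
theorem tZ_true_eq_diagCyclicTrace : tZ ρ M n₁ N β true = diagCyclicTrace ρ β M n₁ N (G := G) := by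
  unfold tZ diagCyclicTrace
  rw [← (measurePreserving_layerEquiv (M := M) (n₁ := n₁) (N := N) (G := G)).integral_comp']
  refine integral_congr_ae (ae_of_all _ fun U => ?_)
  simp only [layerEquiv_apply, tweight_true_eq_prod_stepKernel]

/-- The cyclic trace is the partition function, hence positive (continuous `ρ`). -/
theorem diagCyclicTrace_pos [SecondCountableTopology G] (hρ : Continuous ρ) :
    0 < diagCyclicTrace ρ β M n₁ N (G := G) := by
  rw [← tZ_true_eq_diagCyclicTrace]
  exact RpClosure.tZ_pos ρ β true hρ

/-- **Unnormalised expectations as cyclic integrals with an insertion**: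
`∫ F · exp(β·action) dHaar = ∫ F(assembled layers) ∏_v K(Z_v, Z_{v+1}) dHaar`. -/
theorem integral_mul_tweight_true_eq (F : TConfig M n₁ N G → ℂ) :
    ∫ U, F U * ((tweight ρ β true U : ℝ) : ℂ) ∂(thaar M n₁ N) =
      ∫ Z : ZMod M → LayerCfg n₁ N G, F (layerAssemble Z) *
        ((∏ t : ZMod M, stepKernel ρ β (Z t) (Z (t + 1)) : ℝ) : ℂ) ∂(Measure.pi fun _ => layerHaar n₁ N G) := by
  rw [← (measurePreserving_layerEquiv (M := M) (n₁ := n₁) (N := N) (G := G)).integral_comp']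
  refine integral_congr_ae (ae_of_all _ fun U => ?_)
  simp only [layerEquiv_apply, tweight_true_eq_prod_stepKernel, layerAssemble_layerRead]

/-- **Expectations on the sheared box torus through the step kernel**: `⟨F⟩ = (∫ F ∏ K) / (∫ ∏ K)`. -/
theorem texp_true_eq (F : TConfig M n₁ N G → ℂ) :
    texp ρ β true F =
      (∫ Z : ZMod M → LayerCfg n₁ N G, F (layerAssemble Z) *
          ((∏ t : ZMod M, stepKernel ρ β (Z t) (Z (t + 1)) : ℝ) : ℂ) ∂(Measure.pi fun _ => layerHaar n₁ N G)) /
        ((diagCyclicTrace ρ β M n₁ N (G := G) : ℝ) : ℂ) := by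
  unfold texp
  rw [integral_mul_tweight_true_eq, tZ_true_eq_diagCyclicTrace]

end Cyclic

/-! ## §5 Wilson's measure on the standard torus of side `S` through the light-cone chart -/

section Standard

variable {S : ℕ} [NeZero S]
variable {G : Type} [Group G] [TopologicalSpace G] [IsTopologicalGroup G] [CompactSpace G] [MeasurableSpace G]
  [BorelSpace G] {Nc : ℕ} (ρ : G →* Matrix (Fin Nc) (Fin Nc) ℂ) (β : ℝ)

omit [NeZero S] [TopologicalSpace G] [IsTopologicalGroup G] [CompactSpace G] [MeasurableSpace G] [BorelSpace G] in
/-- The sum over the plaquettes of the standard torus is the ordered-pair sum over its sites. -/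
theorem sum_plaquette_eq' [NeZero S] (g : Literature.MathematicalPhysics.QuantumFieldTheory.Site 4 S → Fin 4 → Fin 4 → ℝ) :
    ∑ p : Plaquette 4 S, g p.1 p.2.1.1 p.2.1.2 =
      ∑ x : Literature.MathematicalPhysics.QuantumFieldTheory.Site 4 S, ∑ i : Fin 4, ∑ j : Fin 4,
        if i < j then g x i j else 0 := by
  -- adapted from `sum_plaquette_eq` (Theorems/PencilRigidityDiagonalMirrorRPRTorusBridge)
  rw [Fintype.sum_prod_type]
  refine Finset.sum_congr rfl fun x _ => ?_
  have h : ∑ q : {q : Fin 4 × Fin 4 // q.1 < q.2}, g x q.1.1 q.1.2 =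
      ∑ q : Fin 4 × Fin 4, if q.1 < q.2 then g x q.1 q.2 else 0 := by
    rw [← Finset.sum_filter, ← Finset.sum_subtype_eq_sum_filter, Finset.subtype_univ]
  rw [h, Fintype.sum_prod_type]

omit [TopologicalSpace G] [IsTopologicalGroup G] [CompactSpace G] [MeasurableSpace G] [BorelSpace G] in
/-- **The Wilson action in the light-cone chart**: `S(diagConfig V) = N_c · #plaquettes − taction ρ true V`. -/
theorem wilsonAction_diagConfig (V : TConfig S S S G) :
    wilsonAction ρ (diagConfig V) = (Nc : ℝ) * Fintype.card (Plaquette 4 S) - taction ρ true V := by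
  unfold wilsonAction
  rw [Finset.sum_sub_distrib, Finset.sum_const, Finset.card_univ, nsmul_eq_mul, mul_comm]
  congr 1
  rw [sum_plaquette_eq' (fun x i j => (ρ (plaquetteHolonomy (diagConfig V) x i j)).trace.re)]
  unfold taction
  rw [← diagSite.sum_comp]
  simp only [plaquetteHolonomy_diagConfig]

/-- The light-cone chart preserves product Haar measure. -/
theorem measurePreserving_diagConfigEquiv :
    MeasurePreserving (diagConfigEquiv : TConfig S S S G ≃ᵐ GaugeConfig 4 S G) (thaar S S S)
      (Measure.pi fun _ : Literature.MathematicalPhysics.QuantumFieldTheory.Edge 4 S => haarProbability G) := by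
  unfold thaar diagConfigEquiv
  exact measurePreserving_piCongrLeft
    (μ := fun _ : Literature.MathematicalPhysics.QuantumFieldTheory.Edge 4 S => haarProbability G) (diagEdge (S := S)).symm

variable [SecondCountableTopology G]

/-- Wilson expectations as Gibbs averages against product Haar measure. -/
theorem integral_wilsonMeasure_eq_div'' (hρ : Continuous ρ) (F : GaugeConfig 4 S G → ℝ) :
    ∫ U, F U ∂(wilsonMeasure ρ β) =
      (∫ U, F U * Real.exp (-β * wilsonAction ρ U)
          ∂(Measure.pi fun _ : Literature.MathematicalPhysics.QuantumFieldTheory.Edge 4 S => haarProbability G)) /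
        ∫ U, Real.exp (-β * wilsonAction ρ U)
          ∂(Measure.pi fun _ : Literature.MathematicalPhysics.QuantumFieldTheory.Edge 4 S => haarProbability G) := by
  -- adapted from `integral_wilsonMeasure_eq_div'` (Theorems/PencilRigidityDiagonalMirrorRPRTorusBridge)
  have hw : Measurable fun U : GaugeConfig 4 S G => ENNReal.ofReal (Real.exp (-β * wilsonAction ρ U)) :=
    (Real.measurable_exp.comp ((measurable_wilsonAction ρ hρ).const_mul _)).ennreal_ofReal
  have hZ : partitionFunction (d := 4) (L := S) ρ β =
      ∫⁻ U, ENNReal.ofReal (Real.exp (-β * wilsonAction ρ U))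
        ∂(Measure.pi fun _ : Literature.MathematicalPhysics.QuantumFieldTheory.Edge 4 S => haarProbability G) := by
    simp only [partitionFunction, wilsonWeight, withDensity_apply _ MeasurableSet.univ, Measure.restrict_univ]
  have hZreal : (partitionFunction (d := 4) (L := S) ρ β).toReal =
      ∫ U, Real.exp (-β * wilsonAction ρ U)
        ∂(Measure.pi fun _ : Literature.MathematicalPhysics.QuantumFieldTheory.Edge 4 S => haarProbability G) := by
    rw [hZ, integral_eq_lintegral_of_nonneg_ae (ae_of_all _ fun U => (Real.exp_pos _).le)]
    exact (Real.measurable_exp.comp ((measurable_wilsonAction ρ hρ).const_mul _)).aestronglyMeasurable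
  unfold wilsonMeasure
  rw [integral_smul_measure, wilsonWeight, integral_withDensity_eq_integral_toReal_smul hw
    (ae_of_all _ fun _ => ENNReal.ofReal_lt_top), ENNReal.toReal_inv, hZreal, smul_eq_mul, inv_mul_eq_div]
  congr 1
  refine integral_congr_ae (ae_of_all _ fun U => ?_)
  beta_reduce
  rw [ENNReal.toReal_ofReal (Real.exp_pos _).le, smul_eq_mul, mul_comm]

omit [MeasurableSpace G] [TopologicalSpace G] [IsTopologicalGroup G] [CompactSpace G] [BorelSpace G]
  [SecondCountableTopology G] in
/-- The Boltzmann factor of the standard torus in the chart is a CONSTANT multiple of the sheared box weight. -/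
theorem exp_neg_mul_wilsonAction_diagConfig (V : TConfig S S S G) :
    Real.exp (-β * wilsonAction ρ (diagConfig V)) =
      Real.exp (-β * ((Nc : ℝ) * Fintype.card (Plaquette 4 S))) * tweight ρ β true V := by
  rw [wilsonAction_diagConfig, tweight, ← Real.exp_add]
  congr 1
  ring

/-- **The standard torus of side `S` IS the sheared box torus `(S, S, S)`**: for a real observable `F`,
`∫ F d(wilsonMeasure ρ β) = Re ⟨F ∘ diagConfig⟩` with `⟨·⟩ = texp ρ β true`. -/
theorem integral_wilsonMeasure_eq_texp_true (hρ : Continuous ρ) (F : GaugeConfig 4 S G → ℝ) :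
    ∫ U, F U ∂(wilsonMeasure ρ β) =
      (texp ρ β true fun V : TConfig S S S G => ((F (diagConfig V) : ℝ) : ℂ)).re := by
  rw [integral_wilsonMeasure_eq_div'' ρ β hρ, RpClosure.texp_ofReal, Complex.ofReal_re]
  have hmp := measurePreserving_diagConfigEquiv (S := S) (G := G)
  rw [← hmp.integral_comp', ← hmp.integral_comp']
  simp only [diagConfigEquiv_apply, exp_neg_mul_wilsonAction_diagConfig ρ β]
  set c : ℝ := Real.exp (-β * ((Nc : ℝ) * Fintype.card (Plaquette 4 S))) with hc
  have hc0 : c ≠ 0 := (Real.exp_pos _).ne'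
  have h1 : ∫ V : TConfig S S S G, F (diagConfig V) * (c * tweight ρ β true V) ∂(thaar S S S) =
      c * ∫ V : TConfig S S S G, F (diagConfig V) * tweight ρ β true V ∂(thaar S S S) := by
    rw [← integral_const_mul]
    refine integral_congr_ae (ae_of_all _ fun V => ?_)
    ring
  have h2 : ∫ V : TConfig S S S G, c * tweight ρ β true V ∂(thaar S S S) = c * tZ ρ S S S β true := by
    rw [integral_const_mul, tZ]
  rw [h1, h2, mul_div_mul_left _ _ hc0]

/-- **Wilson's measure on the standard torus through the diagonal two-step kernel**:
`∫ F d(wilsonMeasure ρ β) = (∫ F(diagConfig (assembled layers)) ∏_{v : ℤ_S} K(Z_v, Z_{v+1}) dHaar) / (∫ ∏_v K dHaar)`. -/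
theorem integral_wilsonMeasure_eq_diagCyclic (hρ : Continuous ρ) (F : GaugeConfig 4 S G → ℝ) :
    ∫ U, F U ∂(wilsonMeasure ρ β) =
      (∫ Z : ZMod S → LayerCfg S S G, F (diagConfig (layerAssemble Z)) *
          ∏ t : ZMod S, stepKernel ρ β (Z t) (Z (t + 1)) ∂(Measure.pi fun _ => layerHaar S S G)) /
        diagCyclicTrace ρ β S S S (G := G) := by
  rw [integral_wilsonMeasure_eq_texp_true ρ β hρ, texp_true_eq]
  simp only [← Complex.ofReal_mul, integral_complex_ofReal, ← Complex.ofReal_div, Complex.ofReal_re]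

/-- **`latticeSchwinger` through the diagonal kernel**: the scheme's joint lattice `n`-point function at step `k` is the
normalised cyclic `S_k`-fold integral of the step kernel with the product of smeared fields inserted. -/
theorem latticeSchwinger_eq_diagCyclic (hρ : Continuous ρ) {ι : Type} (sch : SpeciesScheme ι)
    (obs : ι → LGConfig 4 G → ℝ) (k n : ℕ) (σ : Fin n → ι) (f : Fin n → SchwartzMap (EuclideanSpace ℝ (Fin 4)) ℝ) :
    latticeSchwinger ρ sch obs k n σ f =
      (∫ Z : ZMod (sch.side k) → LayerCfg (sch.side k) (sch.side k) G,
          (∏ i, smearedLatticeField (obs (σ i)) (Literature.Probability.LatticeModels.box 4 (sch.L k)) (sch.a k)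
              (sch.c (σ i) k) (sch.m (σ i) k) (f i) (torusLift (sch.side k) (diagConfig (layerAssemble Z)))) *
            ∏ t : ZMod (sch.side k), stepKernel ρ (sch.β k) (Z t) (Z (t + 1))
          ∂(Measure.pi fun _ => layerHaar (sch.side k) (sch.side k) G)) /
        diagCyclicTrace ρ (sch.β k) (sch.side k) (sch.side k) (sch.side k) (G := G) := by
  unfold latticeSchwinger
  exact integral_wilsonMeasure_eq_diagCyclic ρ (sch.β k) hρ _

end Standard



end Summit.QuantumFields.YangMills.Cruxes.DiagonalMirrorRPR.SignTwistedDiagonalTrace.WilsonDiagonal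

end
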